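import Summits.NavierStokesRegularity.NavierStokesRegularity.Theorems.ExtremiserTransienceTwoThirdsGauge
import Summits.NavierStokesRegularity.NavierStokesRegularity.Theorems.ExtremiserTransienceTwoThirdsGaugeFar
import Summits.NavierStokesRegularity.NavierStokesRegularity.Theorems.ExtremiserTransienceTwoThirdsGaugeSup
import HarnessLib

/-!
# Route `ExtremiserTransience`, crux `NearExtremalTransiencePerFlow` (stmt-NavierStokesRegularity-26567),
# LINE g10-1 «two_thirds» (ns-idea-10), stub S1a′ — BRICK 2, lemma P2: QUANTITATIVE BOUNDS for the local Coulomb gauge of a piece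

`--supports stmt-NavierStokesRegularity-26567` (helper; prover seat ns-net-p2 g12; design = evidence #59 on ⟨26567⟩).  Normalised units (`‖w‖ ≤ 1`,
linear local-energy growth `∫_{B(x,r)}|w|² ≤ A_E r` at every centre).  For a cut-off `ζ` of the cell `B(c, 4ρ)` (`|ζ| ≤ 1`, `ζ = 1` on `B(c, 2ρ)`,
`ζ = 0` off `B(c, 4ρ)`, `‖∇ζ‖ ≤ C_ζ/ρ`) the source of the harmonic remainder `g = div(ζw) = ∇ζ·w` (for divergence-free `w`) lives in the shell
`2ρ ≤ |y − c| ≤ 4ρ` and has mass `∫|g| ≤ (25/2)·C_ζ·(A_E + 4π/3)·ρ`; hence on the piece region `B̄(c, 3ρ/2)` (distance `≥ ρ/2` from the source):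

* `remainder_source_bounds` — `g` is continuous, compactly supported, vanishes on `B(c, 2ρ)`, `|g| ≤ (C_ζ/ρ)‖w‖·1_{B̄(c,4ρ)}`, mass bound;
* `norm_fderiv_remainder_le` — `‖∇Π(x)‖ ≤ (25/2)·C_ζ(A_E + 4π/3)/(π ρ)` for `dist x c ≤ 3ρ/2` (`norm_fderiv_newtonPotential_le_far`, p722043);
* `abs_fderiv_fderiv_remainder_le` — `|∂_b∂_a Π(x)| ≤ 100·C_ζ(A_E + 4π/3)‖a‖‖b‖/(π ρ²)` there (`abs_fderiv_fderiv_newtonPotential_le_far`);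
* `norm_gauge_le` — `‖(K∗(ζw))(x)‖ ≤ 1 + (K+1)(A_E + 4π/3)/(2π)` for `dist x c < 4ρ` whenever `8ρ ≤ 2^{K+1}` (`norm_biotSavart_le_of_ballEnergy`, GaugeSup).
HONEST FRAMING: potential theory bookkeeping; nothing about Navier–Stokes is proved; no summit is proved by a line. [folklore]
-/

noncomputable section

open scoped Topology InnerProductSpace RealInnerProductSpace ENNReal NNReal ContDiff
open MeasureTheory Filter Set Metric Function
open Literature.Analysis Literature.Analysis.FluidPDE

namespace Summit.NavierStokesRegularity.NavierStokesRegularity.Theorems.NearExtremalTransiencePerFlow.TwoThirds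

-- the problem directory repeats the summit name (`NavierStokesRegularity/NavierStokesRegularity`)
set_option linter.dupNamespace false
set_option linter.style.longLine false

section GaugeBounds

variable {w : EuclideanSpace ℝ (Fin 3) → EuclideanSpace ℝ (Fin 3)} {ζ : EuclideanSpace ℝ (Fin 3) → ℝ}
  {c : EuclideanSpace ℝ (Fin 3)} {ρ Cζ A_E : ℝ}

/-- **The source of the harmonic remainder.**  For divergence-free smooth `w` and a smooth cell cut-off `ζ` (`ζ = 0` off `B(c,4ρ)`, `ζ = 1` on
`B(c,2ρ)`, `‖∇ζ‖ ≤ C_ζ/ρ`): `g = div(ζw)` is continuous, compactly supported, equals `∇ζ·w`, vanishes on `B(c,2ρ)`, and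
`|g y| ≤ (C_ζ/ρ)·‖w y‖·1_{B̄(c,4ρ)}(y)`. -/
theorem remainder_source_bounds (hw : ContDiff ℝ (⊤ : ℕ∞) w) (hdiv : VectorCalculus.IsDivFree w) (hζ : ContDiff ℝ (⊤ : ℕ∞) ζ)
    (hζsupp : ∀ y, ζ y ≠ 0 → dist y c < 4 * ρ) (hζone : ∀ y, dist y c < 2 * ρ → ζ y = 1)
    (hζgrad : ∀ y, ‖fderiv ℝ ζ y‖ ≤ Cζ / ρ) (hCζ : 0 ≤ Cζ) (hρ : 0 < ρ) :
    Continuous (VectorCalculus.divergence fun y => ζ y • w y) ∧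
      HasCompactSupport (VectorCalculus.divergence fun y => ζ y • w y) ∧
      (∀ y, dist y c < 2 * ρ → VectorCalculus.divergence (fun y => ζ y • w y) y = 0) ∧
      (∀ y, VectorCalculus.divergence (fun y => ζ y • w y) y ≠ 0 → 2 * ρ ≤ dist y c) ∧
      (∀ y, |VectorCalculus.divergence (fun y => ζ y • w y) y| ≤
        (Metric.closedBall c (4 * ρ)).indicator (fun y => Cζ / ρ * ‖w y‖) y) := by
  have hζc : HasCompactSupport ζ := by
    refine HasCompactSupport.of_support_subset_isCompact (isCompact_closedBall c (4 * ρ)) fun y hy => ?_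
    exact Metric.mem_closedBall.2 (hζsupp y hy).le
  have hh1 : ContDiff ℝ 1 (fun y => ζ y • w y) := (hζ.smul hw).of_le (by norm_cast)
  have hhc : HasCompactSupport (fun y => ζ y • w y) := hζc.smul_right
  have hζd : ∀ y, DifferentiableAt ℝ ζ y := fun y => (hζ.differentiable (by simp)) y
  have hwd : ∀ y, DifferentiableAt ℝ w y := fun y => (hw.differentiable (by simp)) y
  -- the pointwise identity `div(ζw) = Dζ(w)`
  have hid : ∀ y, VectorCalculus.divergence (fun y => ζ y • w y) y = fderiv ℝ ζ y (w y) := fun y =>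
    divergence_smul_of_isDivFree (hζd y) (hwd y) (hdiv y)
  -- `Dζ = 0` on the open ball `B(c, 2ρ)` (where `ζ ≡ 1`) and off the closed ball `B̄(c, 4ρ)` (where `ζ ≡ 0` nearby)
  have hD0_in : ∀ y, dist y c < 2 * ρ → fderiv ℝ ζ y = 0 := by
    intro y hy
    have hev : ζ =ᶠ[𝓝 y] fun _ => (1 : ℝ) := by
      filter_upwards [Metric.isOpen_ball.mem_nhds (Metric.mem_ball.2 hy)] with z hz
      exact hζone z (Metric.mem_ball.1 hz)
    rw [hev.fderiv_eq, fderiv_const_apply]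
  have hD0_out : ∀ y, fderiv ℝ ζ y ≠ 0 → y ∈ Metric.closedBall c (4 * ρ) := by
    intro y hy
    have hy' : y ∈ tsupport (fderiv ℝ ζ) := subset_closure (Function.mem_support.2 hy)
    have hy'' : y ∈ tsupport ζ := tsupport_fderiv_subset ℝ hy'
    -- `tsupport ζ ⊆ B̄(c, 4ρ)`
    have hsub : tsupport ζ ⊆ Metric.closedBall c (4 * ρ) :=
      closure_minimal (fun z hz => Metric.mem_closedBall.2 (hζsupp z hz).le) Metric.isClosed_closedBall
    exact hsub hy''
  refine ⟨continuous_divergence_of_test hh1, hasCompactSupport_divergence hhc, fun y hy => ?_, fun y hy => ?_, fun y => ?_⟩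
  · rw [hid, hD0_in y hy]; simp
  · by_contra hlt
    push Not at hlt
    exact hy (by rw [hid, hD0_in y hlt]; simp)
  · rw [hid]
    by_cases hD : fderiv ℝ ζ y = 0
    · rw [hD]
      simp only [zero_apply, abs_zero]
      exact Set.indicator_nonneg (fun z _ => by positivity) y
    · rw [Set.indicator_of_mem (hD0_out y hD)]
      calc |fderiv ℝ ζ y (w y)| = ‖fderiv ℝ ζ y (w y)‖ := (Real.norm_eq_abs _).symm
        _ ≤ ‖fderiv ℝ ζ y‖ * ‖w y‖ := (fderiv ℝ ζ y).le_opNorm _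
        _ ≤ Cζ / ρ * ‖w y‖ := mul_le_mul_of_nonneg_right (hζgrad y) (norm_nonneg _)

/-- **Mass of the source**: `∫|g| ≤ (25/2)·C_ζ·(A_E + 4π/3)·ρ` (AM–GM on `B(c, 5ρ)` with the ball-energy bound). -/
theorem integral_abs_remainder_source_le (hw : ContDiff ℝ (⊤ : ℕ∞) w) (hdiv : VectorCalculus.IsDivFree w) (hζ : ContDiff ℝ (⊤ : ℕ∞) ζ)
    (hζsupp : ∀ y, ζ y ≠ 0 → dist y c < 4 * ρ) (hζone : ∀ y, dist y c < 2 * ρ → ζ y = 1)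
    (hζgrad : ∀ y, ‖fderiv ℝ ζ y‖ ≤ Cζ / ρ) (hCζ : 0 ≤ Cζ) (hρ : 0 < ρ)
    (hE : ∫ y in Metric.ball c (5 * ρ), ‖w y‖ ^ 2 ≤ A_E * (5 * ρ)) :
    ∫ y, |VectorCalculus.divergence (fun y => ζ y • w y) y| ≤ 25 / 2 * Cζ * (A_E + 4 * Real.pi / 3) * ρ := by
  obtain ⟨hgc, hgsupp, -, -, hgle⟩ := remainder_source_bounds hw hdiv hζ hζsupp hζone hζgrad hCζ hρ
  have hwc : Continuous w := hw.continuous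
  have hint_ball : IntegrableOn (fun y => ‖w y‖) (Metric.ball c (5 * ρ)) :=
    (hwc.norm.continuousOn.integrableOn_compact (isCompact_closedBall c (5 * ρ))).mono_set Metric.ball_subset_closedBall
  have hint_cb : IntegrableOn (fun y => Cζ / ρ * ‖w y‖) (Metric.closedBall c (4 * ρ)) :=
    ((hwc.norm.continuousOn.integrableOn_compact (isCompact_closedBall c (4 * ρ))).const_mul _)
  have h1 : ∫ y, |VectorCalculus.divergence (fun y => ζ y • w y) y| ≤
      ∫ y, (Metric.closedBall c (4 * ρ)).indicator (fun y => Cζ / ρ * ‖w y‖) y :=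
    integral_mono (hgc.abs.integrable_of_hasCompactSupport hgsupp.abs)
      ((integrable_indicator_iff Metric.isClosed_closedBall.measurableSet).2 hint_cb) hgle
  rw [integral_indicator Metric.isClosed_closedBall.measurableSet] at h1
  have h2 : ∫ y in Metric.closedBall c (4 * ρ), Cζ / ρ * ‖w y‖ ≤ ∫ y in Metric.ball c (5 * ρ), Cζ / ρ * ‖w y‖ :=
    setIntegral_mono_set (hint_ball.const_mul _) (Eventually.of_forall fun y => by positivity)
      (Eventually.of_forall fun y hy => Metric.mem_ball.2 (lt_of_le_of_lt (Metric.mem_closedBall.1 hy) (by linarith)))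
  have h3 : ∫ y in Metric.ball c (5 * ρ), ‖w y‖ ≤ (5 * ρ) ^ 2 * (A_E + 4 * Real.pi / 3) / 2 :=
    setIntegral_norm_le_of_ballEnergy hwc (by positivity) hE
  calc ∫ y, |VectorCalculus.divergence (fun y => ζ y • w y) y|
      ≤ ∫ y in Metric.ball c (5 * ρ), Cζ / ρ * ‖w y‖ := h1.trans h2
    _ = Cζ / ρ * ∫ y in Metric.ball c (5 * ρ), ‖w y‖ := integral_const_mul _ _
    _ ≤ Cζ / ρ * ((5 * ρ) ^ 2 * (A_E + 4 * Real.pi / 3) / 2) := mul_le_mul_of_nonneg_left h3 (by positivity)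
    _ = 25 / 2 * Cζ * (A_E + 4 * Real.pi / 3) * ρ := by field_simp; ring

/-- **The harmonic remainder's gradient on the piece region**: `‖∇Π(x)‖ ≤ (25/2)·C_ζ(A_E + 4π/3)/(π ρ)` for `dist x c ≤ 3ρ/2`. -/
theorem norm_fderiv_remainder_le (hw : ContDiff ℝ (⊤ : ℕ∞) w) (hdiv : VectorCalculus.IsDivFree w) (hζ : ContDiff ℝ (⊤ : ℕ∞) ζ)
    (hζsupp : ∀ y, ζ y ≠ 0 → dist y c < 4 * ρ) (hζone : ∀ y, dist y c < 2 * ρ → ζ y = 1)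
    (hζgrad : ∀ y, ‖fderiv ℝ ζ y‖ ≤ Cζ / ρ) (hCζ : 0 ≤ Cζ) (hρ : 0 < ρ)
    (hE : ∫ y in Metric.ball c (5 * ρ), ‖w y‖ ^ 2 ≤ A_E * (5 * ρ)) (hAE : 0 ≤ A_E)
    {x : EuclideanSpace ℝ (Fin 3)} (hx : dist x c ≤ 3 * ρ / 2) :
    ‖fderiv ℝ (fun x' => ∫ y, newtonKernel (x' - y) * VectorCalculus.divergence (fun y => ζ y • w y) y) x‖ ≤
      25 / 2 * Cζ * (A_E + 4 * Real.pi / 3) / (Real.pi * ρ) := by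
  obtain ⟨hgc, hgsupp, -, hfar', -⟩ := remainder_source_bounds hw hdiv hζ hζsupp hζone hζgrad hCζ hρ
  have hfar : ∀ y, VectorCalculus.divergence (fun y => ζ y • w y) y ≠ 0 → ρ / 2 ≤ ‖x - y‖ := by
    intro y hy
    have h2 := hfar' y hy
    have htri : dist y c ≤ dist y x + dist x c := dist_triangle y x c
    rw [← dist_eq_norm, dist_comm]
    linarith
  have hmass := integral_abs_remainder_source_le hw hdiv hζ hζsupp hζone hζgrad hCζ hρ hE
  refine (norm_fderiv_newtonPotential_le_far hgc hgsupp (by positivity : (0:ℝ) < ρ / 2) hfar).trans ?_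
  calc (4 * Real.pi * (ρ / 2) ^ 2)⁻¹ * ∫ y, |VectorCalculus.divergence (fun y => ζ y • w y) y|
      ≤ (4 * Real.pi * (ρ / 2) ^ 2)⁻¹ * (25 / 2 * Cζ * (A_E + 4 * Real.pi / 3) * ρ) :=
        mul_le_mul_of_nonneg_left hmass (by positivity)
    _ = 25 / 2 * Cζ * (A_E + 4 * Real.pi / 3) / (Real.pi * ρ) := by field_simp; ring

/-- **The harmonic remainder's second derivatives on the piece region**: `|∂_b ∂_a Π(x)| ≤ 100·C_ζ(A_E + 4π/3)‖a‖‖b‖/(π ρ²)` for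
`dist x c ≤ 3ρ/2`, with differentiability of `∂_a Π` at `x`. -/
theorem abs_fderiv_fderiv_remainder_le (hw : ContDiff ℝ (⊤ : ℕ∞) w) (hdiv : VectorCalculus.IsDivFree w) (hζ : ContDiff ℝ (⊤ : ℕ∞) ζ)
    (hζsupp : ∀ y, ζ y ≠ 0 → dist y c < 4 * ρ) (hζone : ∀ y, dist y c < 2 * ρ → ζ y = 1)
    (hζgrad : ∀ y, ‖fderiv ℝ ζ y‖ ≤ Cζ / ρ) (hCζ : 0 ≤ Cζ) (hρ : 0 < ρ)
    (hE : ∫ y in Metric.ball c (5 * ρ), ‖w y‖ ^ 2 ≤ A_E * (5 * ρ)) (hAE : 0 ≤ A_E)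
    {x : EuclideanSpace ℝ (Fin 3)} (hx : dist x c ≤ 3 * ρ / 2) (a b : EuclideanSpace ℝ (Fin 3)) :
    DifferentiableAt ℝ (fun x' => fderiv ℝ (fun x'' => ∫ y, newtonKernel (x'' - y) * VectorCalculus.divergence (fun y => ζ y • w y) y) x' a) x ∧
    |fderiv ℝ (fun x' => fderiv ℝ (fun x'' => ∫ y, newtonKernel (x'' - y) * VectorCalculus.divergence (fun y => ζ y • w y) y) x' a) x b| ≤
      100 * Cζ * (A_E + 4 * Real.pi / 3) * ‖a‖ * ‖b‖ / (Real.pi * ρ ^ 2) := by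
  obtain ⟨hgc, hgsupp, -, hfar', -⟩ := remainder_source_bounds hw hdiv hζ hζsupp hζone hζgrad hCζ hρ
  have hfar : ∀ y, VectorCalculus.divergence (fun y => ζ y • w y) y ≠ 0 → ρ / 2 ≤ ‖x - y‖ := by
    intro y hy
    have h2 := hfar' y hy
    have htri : dist y c ≤ dist y x + dist x c := dist_triangle y x c
    rw [← dist_eq_norm, dist_comm]
    linarith
  have hmass := integral_abs_remainder_source_le hw hdiv hζ hζsupp hζone hζgrad hCζ hρ hE
  obtain ⟨hdiff, hle⟩ := abs_fderiv_fderiv_newtonPotential_le_far hgc hgsupp (by positivity : (0:ℝ) < ρ / 2) hfar a b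
  refine ⟨hdiff, hle.trans ?_⟩
  calc ‖a‖ * ‖b‖ / (Real.pi * (ρ / 2) ^ 3) * ∫ y, |VectorCalculus.divergence (fun y => ζ y • w y) y|
      ≤ ‖a‖ * ‖b‖ / (Real.pi * (ρ / 2) ^ 3) * (25 / 2 * Cζ * (A_E + 4 * Real.pi / 3) * ρ) :=
        mul_le_mul_of_nonneg_left hmass (by positivity)
    _ = 100 * Cζ * (A_E + 4 * Real.pi / 3) * ‖a‖ * ‖b‖ / (Real.pi * ρ ^ 2) := by field_simp; ring

/-- **The gauge's sup bound on the cell**: `‖(K∗(ζw))(x)‖ ≤ 1 + (K+1)(A_E + 4π/3)/(2π)` for `dist x c < 4ρ` whenever `8ρ ≤ 2^{K+1}`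
(so `K ≍ log₂ ρ`): the near unit ball and `K+1` dyadic shells (GaugeSup `norm_biotSavart_le_of_ballEnergy`). -/
theorem norm_gauge_le (hw : Continuous w) (hw1 : ∀ y, ‖w y‖ ≤ 1) (hζ1 : ∀ y, |ζ y| ≤ 1)
    (hζsupp : ∀ y, ζ y ≠ 0 → dist y c < 4 * ρ)
    (hE : ∀ (x : EuclideanSpace ℝ (Fin 3)) (r : ℝ), 0 < r → ∫ y in Metric.ball x r, ‖w y‖ ^ 2 ≤ A_E * r)
    {K : ℕ} (hK : 8 * ρ ≤ (2 : ℝ) ^ (K + 1)) {x : EuclideanSpace ℝ (Fin 3)} (hx : dist x c < 4 * ρ) :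
    ‖biotSavart (fun y => ζ y • w y) x‖ ≤ 1 + (K + 1) * (A_E + 4 * Real.pi / 3) / (2 * Real.pi) := by
  refine norm_biotSavart_le_of_ballEnergy (V := w) hw (fun y => ?_) (fun y => ?_) (fun y hy => ?_) (hE x)
  · rw [norm_smul, Real.norm_eq_abs]
    calc |ζ y| * ‖w y‖ ≤ 1 * 1 := mul_le_mul (hζ1 y) (hw1 y) (norm_nonneg _) zero_le_one
      _ = 1 := one_mul 1
  · rw [norm_smul, Real.norm_eq_abs]
    calc |ζ y| * ‖w y‖ ≤ 1 * ‖w y‖ := mul_le_mul_of_nonneg_right (hζ1 y) (norm_nonneg _)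
      _ = ‖w y‖ := one_mul _
  · have hζy : ζ y ≠ 0 := by
      intro h0; apply hy; rw [h0, zero_smul]
    have h1 := hζsupp y hζy
    calc dist y x ≤ dist y c + dist c x := dist_triangle y c x
      _ < 4 * ρ + 4 * ρ := by rw [dist_comm c x]; linarith
      _ = 8 * ρ := by ring
      _ ≤ (2 : ℝ) ^ (K + 1) := hK

end GaugeBounds

end Summit.NavierStokesRegularity.NavierStokesRegularity.Theorems.NearExtremalTransiencePerFlow.TwoThirds

end
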